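import Summits.SmoothPoincare4.SmoothPoincare4.Theorems.SullivanDualTargetOfSympcap
import Summits.SmoothPoincare4.SmoothPoincare4.Theorems.SullivanDualTarget

/-!
# SmoothPoincare4 / SullivanDual — crux `Target` (stmt-SmoothPoincare4-7823), line `Sketch`
# SKELETON v6 (continuation lead c4) — composition unchanged (one stub, verbatim item 0518);
# the line's two ENTRY DOORS for the crux ideas are now landed

Composition: `Target_of : …Theses.SullivanDual.Target` ⇐ `stub_sympcapThesisV2` ALONE, through
the LANDED equivalence `SullivanDual.target_iff_sympcapThesisV2` (p119400,
`Theorems/SullivanDualTargetOfSympcap.lean`; both directions unconditional, no Gromov):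

* `stub_sympcapThesisV2` — the ONLY stub: VERBATIM the open crux `stmt-SmoothPoincare4-0518`
  (`SympcapThesisV2`) of route SymplecticCap. It is formally EQUIVALENT to the crux, implied by
  SPC4 unconditionally and implies SPC4 modulo the route's single named-fact debt
  `GromovChartForm` (`target_and_gromovChartForm_iff_smoothPoincare4`, p120412): the residual
  stub is the summit itself; no worker-sized stub can exist on this line.

Landed under c4 (all `--supports stmt-SmoothPoincare4-7823`), the doors through which the four
crux ideas (`Cruxes/Target/Ideas/*.md`) plan to close the crux:
* door (a) `SullivanDual.target_of_tamingForm` / `targetAt_of_tamingForm` (p121896,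
  `Theorems/SullivanDualTargetOfTamingForm.lean`): one smooth closed form standard on `B_{ε₁}`
  taming a smooth `J` ⇒ `Target` (ideas `kaehler-jacket`, `last-twisted-circle`);
* door (b) `SullivanDual.closedTamingKillsWitnesses` / `target_of_weakTame` (+ converse
  `target_iff_weakTame` mod `GromovChartForm`; `Theorems/SullivanDualTargetOfWeakTame.lean`):
  `J` standard near `p` + ANY smooth closed taming form ⇒ `Target` (ideas
  `crofton-pencil-laminar-charge`, `taubes-circle-cancellation`), over
  `helper_closedTamingKillsWitnessesOfPrimitive` (p122298), `helper_primitiveOnPuncturedBall`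
  (p122390) and `H²_dR(punctured chart 4-ball) = 0` (`helper_poincareLemma_two_puncturedChartBall`,
  p123620; Mayer–Vietoris helpers p122279 p122473, flat geometry p122259 p122267 p122297).

Everything else of the line is landed earlier: p103080, p103161, p103314, p103855,
p104383/p115634, p115688, p116936, p119400, p119567, p120412.
-/

noncomputable section

-- the registered namespace `Summit.SmoothPoincare4.SmoothPoincare4.Theorems` repeats a component
set_option linter.dupNamespace false

open scoped Manifold ContDiff Topology
open Literature.Geometry.Kaehler Literature.Geometry.Symplectic Literature.Topology.FourManifolds

namespace Summit.SmoothPoincare4.SmoothPoincare4.Theorems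

namespace SullivanDual

/-! ### The transferred crux: route SymplecticCap's thesis (item 0518, verbatim) -/

/-- **Stub (`SympcapThesisV2`, the transferred crux — SPC4-hard; verbatim
`stmt-SmoothPoincare4-0518`).** For every homotopy 4-sphere `Σ` and `p ∈ Σ` there are `ε > 0`
and a `2`-form `sf` on `Σ ∖ p` with `IsSymplecticStandardNearPoint p ε sf`: smooth, closed,
pointwise nondegenerate, and equal on the punctured `ε`-chart-ball to the inverted-chart model
`ι*ω₀` (`e = extChartAt p`, `ι z = z/‖z‖²`). True for `Σ ≅ S⁴`; equivalent to `Target`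
(`target_iff_sympcapThesisV2`), hence to SPC4 given Gromov's recognition of `ℝ⁴`.
[cite: Gromov1985, §0.3.C] -/
theorem stub_sympcapThesisV2 :
    ∀ (S : Literature.Topology.FourManifolds.HomotopySphere 4) (p : S.carrier),
      ∃ (ε : ℝ) (sf : Literature.Geometry.Kaehler.MForm (𝓡 4)
        (Literature.Geometry.Symplectic.punctured p) ℝ 2),
        Literature.Geometry.Symplectic.IsSymplecticStandardNearPoint p ε sf := by
  sorry

end SullivanDual

/-! ### Composition: the crux `Target` from the stub -/

/-- **`Target` of route SullivanDual from `SympcapThesisV2`**: the landed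
`SullivanDual.target_of_sympcapThesisV2` (`ε, sf` from the stub; `J` the `sf`-compatible almost
complex structure; the closed standard taming form kills every witness at every radius `≤ ε`).
[folklore] -/
theorem Target_of : Summit.SmoothPoincare4.SmoothPoincare4.Theses.SullivanDual.Target :=
  SullivanDual.target_of_sympcapThesisV2 SullivanDual.stub_sympcapThesisV2

end Summit.SmoothPoincare4.SmoothPoincare4.Theorems

end
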